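import Summits.NavierStokesRegularity.NavierStokesRegularity.Theses.SqueezeCycle
import Summits.NavierStokesRegularity.NavierStokesRegularity.Theorems.SqueezeCycleRecurrentLiouvilleApexOfNoSatellites
import Summits.NavierStokesRegularity.NavierStokesRegularity.Theorems.SqueezeCycleRecurrentLiouvilleDecayedReduction
import HarnessLib

/-!
# Crux `RecurrentLiouville` (stmt-NavierStokesRegularity-1589), line `Sketch` — the crux SPLITS
# exactly into hull satellite-freeness (S1a) and apex-class Type-I Liouville (item 11716)

Theorems-only file (no definitions, no named facts).  Summary theorem of line `Sketch` after the
landing of S1b (`stub_satApexOfNoSatellites`): the crux `Theses.SqueezeCycle.RecurrentLiouville`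
(= `Theses.RecurrentProfiles.RecurrentLiouville`, `Iff.rfl`) is EQUIVALENT to the conjunction of

* (S1a) HULL SATELLITE-FREENESS, ∃-form (the registered open stub `stub_satHullNoSatellites`,
  inlined): if a uniformly recurrent origin-singular class profile exists, then one exists all of
  whose `L³_loc`-limits of rescalings (again singular class profiles) have no backward singular
  point `(0, x)`, `x ≠ 0`; and
* (AL) APEX-CLASS TYPE-I LIOUVILLE (inlined; `Iff.rfl`-identical to the OPEN item
  stmt-NavierStokesRegularity-11716 `Theses.RellichScar.NoApexTypeIProfile`, and equivalent to the
  registered residual stub S2 `stub_satRadiatingLiouville` by `stub_satRadiatingResidualTools`,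
  p124784): a suitable weak solution on `ℝ³ × ℝ₋` with weak gradient, `𝐈 < ⊤` and the apex bound
  `‖u(t,x)‖ ≤ C/(‖x‖ + √(−t))` is regular at the origin.

`satSP_recurrentLiouville_iff_split : RecurrentLiouville ↔ (S1a ∧ AL)`.  (⇒): S1a is vacuous
under the crux; AL follows from the crux through the decayed recurrent reduction S3
(`stub_satDecayedReduction`: a singular apex profile yields a RECURRENT singular apex profile, and
the apex bound implies the rate).  (⇐): S1a, then S1b (`stub_satApexOfNoSatellites`), then AL.
So the two open stubs of the line are exactly the crux cut in two: AL is another route's open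
crux, and S1a is the precise gap between Type-I Liouville in the KNSS apex class and in the
Albritton–Barker class.

## References

* D. Albritton, T. Barker, J. Math. Fluid Mech. 21 (2019), no. 43 = arXiv:1811.00502, Thm. 1.1,
  §3. [AlbrittonBarker2019]
* G. Koch, N. Nadirashvili, G. Seregin, V. Šverák, Acta Math. 203 (2009), (1.4), (1.6). [KNSS2009]
-/

noncomputable section

-- the sub-problem namespace repeats the summit name (D-0017 layout `Summit.<S>.<P>.Theorems`)
set_option linter.dupNamespace false

namespace Summit.NavierStokesRegularity.NavierStokesRegularity.Theorems

open MeasureTheory Set Function Filter Topology TopologicalSpace Metric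
open Literature.Analysis.FluidPDE
open scoped NNReal ENNReal

/-- **The crux implies apex-class Type-I Liouville** (AL, = item 11716's statement verbatim):
a singular apex-class profile would yield, by the decayed recurrent reduction S3
(`stub_satDecayedReduction`), a uniformly recurrent singular apex-class profile, which the crux
excludes (the apex bound implies the rate, `HasTypeIDecay.hasTypeITimeDecay`).
[cite: AlbrittonBarker2019, Thm. 1.1 and §3] -/
theorem satSP_apexLiouville_of_recurrentLiouville (hL : Theses.SqueezeCycle.RecurrentLiouville) :
    ∀ (u : ℝ → EuclideanSpace ℝ (Fin 3) → EuclideanSpace ℝ (Fin 3))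
      (p : ℝ → EuclideanSpace ℝ (Fin 3) → ℝ)
      (G : ℝ → EuclideanSpace ℝ (Fin 3) → EuclideanSpace ℝ (Fin 3) →L[ℝ] EuclideanSpace ℝ (Fin 3)) (C : ℝ),
      IsSuitableWeakSolutionOn (slab (EuclideanSpace ℝ (Fin 3)) (Iio 0) isOpen_Iio) 1 0 u p →
      HasWeakSpatialGradientOn (slab (EuclideanSpace ℝ (Fin 3)) (Iio 0) isOpen_Iio) u G →
      typeIBound (Iio (0 : ℝ) ×ˢ univ) u p G < ⊤ → HasTypeIDecay C u →
      ¬ IsBackwardSingularPoint u 0 := by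
  intro u p G C hsw hwg hI hdec hsing
  obtain ⟨w, q, H, hsw', hwg', hI', hdec', hsing', hrec'⟩ :=
    stub_satDecayedReduction u p G C hsw hwg hI hdec hsing
  have hC0 : 0 ≤ C := by
    have h := hdec (-1) (by norm_num) 0
    have h1 : (0 : ℝ) ≤ C / (‖(0 : EuclideanSpace ℝ (Fin 3))‖ + Real.sqrt (-(-1 : ℝ))) :=
      (norm_nonneg _).trans h
    rw [norm_zero, zero_add, neg_neg, Real.sqrt_one, div_one] at h1
    exact h1
  exact hL w q H C hsw' hwg' hI' (hdec'.hasTypeITimeDecay hC0) hrec' hsing'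

/-- **The crux implies hull satellite-freeness (S1a), vacuously**: under the crux no uniformly
recurrent origin-singular class profile exists. [folklore] -/
theorem satSP_hullNoSatellites_of_recurrentLiouville (hL : Theses.SqueezeCycle.RecurrentLiouville) :
    (∃ (u : ℝ → EuclideanSpace ℝ (Fin 3) → EuclideanSpace ℝ (Fin 3))
      (p : ℝ → EuclideanSpace ℝ (Fin 3) → ℝ)
      (G : ℝ → EuclideanSpace ℝ (Fin 3) → EuclideanSpace ℝ (Fin 3) →L[ℝ] EuclideanSpace ℝ (Fin 3)) (C : ℝ),
      IsSuitableWeakSolutionOn (slab (EuclideanSpace ℝ (Fin 3)) (Iio 0) isOpen_Iio) 1 0 u p ∧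
      HasWeakSpatialGradientOn (slab (EuclideanSpace ℝ (Fin 3)) (Iio 0) isOpen_Iio) u G ∧
      typeIBound (Iio (0 : ℝ) ×ˢ univ) u p G < ⊤ ∧ HasTypeITimeDecay C u ∧
      IsScalingUniformlyRecurrent u ∧ IsBackwardSingularPoint u 0) →
    ∃ (u : ℝ → EuclideanSpace ℝ (Fin 3) → EuclideanSpace ℝ (Fin 3))
      (p : ℝ → EuclideanSpace ℝ (Fin 3) → ℝ)
      (G : ℝ → EuclideanSpace ℝ (Fin 3) → EuclideanSpace ℝ (Fin 3) →L[ℝ] EuclideanSpace ℝ (Fin 3)) (C : ℝ),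
      IsSuitableWeakSolutionOn (slab (EuclideanSpace ℝ (Fin 3)) (Iio 0) isOpen_Iio) 1 0 u p ∧
      HasWeakSpatialGradientOn (slab (EuclideanSpace ℝ (Fin 3)) (Iio 0) isOpen_Iio) u G ∧
      typeIBound (Iio (0 : ℝ) ×ˢ univ) u p G < ⊤ ∧ HasTypeITimeDecay C u ∧
      IsScalingUniformlyRecurrent u ∧ IsBackwardSingularPoint u 0 ∧
      ∀ (c : ℕ → ℝ) (v : ℝ → EuclideanSpace ℝ (Fin 3) → EuclideanSpace ℝ (Fin 3))
        (q : ℝ → EuclideanSpace ℝ (Fin 3) → ℝ)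
        (H : ℝ → EuclideanSpace ℝ (Fin 3) → EuclideanSpace ℝ (Fin 3) →L[ℝ] EuclideanSpace ℝ (Fin 3)),
        (∀ n, 0 < c n) →
        IsSuitableWeakSolutionOn (slab (EuclideanSpace ℝ (Fin 3)) (Iio 0) isOpen_Iio) 1 0 v q →
        HasWeakSpatialGradientOn (slab (EuclideanSpace ℝ (Fin 3)) (Iio 0) isOpen_Iio) v H →
        typeIBound (Iio (0 : ℝ) ×ˢ univ) v q H < ⊤ → HasTypeITimeDecay C v →
        IsBackwardSingularPoint v 0 →
        (∀ R : ℝ, 0 < R → Tendsto (fun n => eLpNorm (uncurry (nsRescale (c n) u) - uncurry v) 3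
          (volume.restrict (parabolicCylinder R (0 : ℝ × EuclideanSpace ℝ (Fin 3))))) atTop (𝓝 0)) →
        ∀ x : EuclideanSpace ℝ (Fin 3), x ≠ 0 → ¬ IsBackwardSingularPoint v (0, x) := by
  rintro ⟨u, p, G, C, hsw, hwg, hI, hdec, hrec, hsing⟩
  exact absurd hsing (hL u p G C hsw hwg hI hdec hrec)

/-- **Hull satellite-freeness (S1a) and apex-class Type-I Liouville (AL) imply the crux**: a
uniformly recurrent origin-singular class profile gives, by S1a, one with satellite-free hull;
S1b (`stub_satApexOfNoSatellites`) makes it an origin-singular APEX-class profile; AL excludes it.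
[cite: AlbrittonBarker2019, Thm. 1.1 and §3] [cite: KNSS2009, (1.6)] -/
theorem satSP_recurrentLiouville_of_split
    (hS1a : (∃ (u : ℝ → EuclideanSpace ℝ (Fin 3) → EuclideanSpace ℝ (Fin 3))
      (p : ℝ → EuclideanSpace ℝ (Fin 3) → ℝ)
      (G : ℝ → EuclideanSpace ℝ (Fin 3) → EuclideanSpace ℝ (Fin 3) →L[ℝ] EuclideanSpace ℝ (Fin 3)) (C : ℝ),
      IsSuitableWeakSolutionOn (slab (EuclideanSpace ℝ (Fin 3)) (Iio 0) isOpen_Iio) 1 0 u p ∧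
      HasWeakSpatialGradientOn (slab (EuclideanSpace ℝ (Fin 3)) (Iio 0) isOpen_Iio) u G ∧
      typeIBound (Iio (0 : ℝ) ×ˢ univ) u p G < ⊤ ∧ HasTypeITimeDecay C u ∧
      IsScalingUniformlyRecurrent u ∧ IsBackwardSingularPoint u 0) →
    ∃ (u : ℝ → EuclideanSpace ℝ (Fin 3) → EuclideanSpace ℝ (Fin 3))
      (p : ℝ → EuclideanSpace ℝ (Fin 3) → ℝ)
      (G : ℝ → EuclideanSpace ℝ (Fin 3) → EuclideanSpace ℝ (Fin 3) →L[ℝ] EuclideanSpace ℝ (Fin 3)) (C : ℝ),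
      IsSuitableWeakSolutionOn (slab (EuclideanSpace ℝ (Fin 3)) (Iio 0) isOpen_Iio) 1 0 u p ∧
      HasWeakSpatialGradientOn (slab (EuclideanSpace ℝ (Fin 3)) (Iio 0) isOpen_Iio) u G ∧
      typeIBound (Iio (0 : ℝ) ×ˢ univ) u p G < ⊤ ∧ HasTypeITimeDecay C u ∧
      IsScalingUniformlyRecurrent u ∧ IsBackwardSingularPoint u 0 ∧
      ∀ (c : ℕ → ℝ) (v : ℝ → EuclideanSpace ℝ (Fin 3) → EuclideanSpace ℝ (Fin 3))
        (q : ℝ → EuclideanSpace ℝ (Fin 3) → ℝ)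
        (H : ℝ → EuclideanSpace ℝ (Fin 3) → EuclideanSpace ℝ (Fin 3) →L[ℝ] EuclideanSpace ℝ (Fin 3)),
        (∀ n, 0 < c n) →
        IsSuitableWeakSolutionOn (slab (EuclideanSpace ℝ (Fin 3)) (Iio 0) isOpen_Iio) 1 0 v q →
        HasWeakSpatialGradientOn (slab (EuclideanSpace ℝ (Fin 3)) (Iio 0) isOpen_Iio) v H →
        typeIBound (Iio (0 : ℝ) ×ˢ univ) v q H < ⊤ → HasTypeITimeDecay C v →
        IsBackwardSingularPoint v 0 →
        (∀ R : ℝ, 0 < R → Tendsto (fun n => eLpNorm (uncurry (nsRescale (c n) u) - uncurry v) 3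
          (volume.restrict (parabolicCylinder R (0 : ℝ × EuclideanSpace ℝ (Fin 3))))) atTop (𝓝 0)) →
        ∀ x : EuclideanSpace ℝ (Fin 3), x ≠ 0 → ¬ IsBackwardSingularPoint v (0, x))
    (hAL : ∀ (u : ℝ → EuclideanSpace ℝ (Fin 3) → EuclideanSpace ℝ (Fin 3))
      (p : ℝ → EuclideanSpace ℝ (Fin 3) → ℝ)
      (G : ℝ → EuclideanSpace ℝ (Fin 3) → EuclideanSpace ℝ (Fin 3) →L[ℝ] EuclideanSpace ℝ (Fin 3)) (C : ℝ),
      IsSuitableWeakSolutionOn (slab (EuclideanSpace ℝ (Fin 3)) (Iio 0) isOpen_Iio) 1 0 u p →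
      HasWeakSpatialGradientOn (slab (EuclideanSpace ℝ (Fin 3)) (Iio 0) isOpen_Iio) u G →
      typeIBound (Iio (0 : ℝ) ×ˢ univ) u p G < ⊤ → HasTypeIDecay C u →
      ¬ IsBackwardSingularPoint u 0) :
    Theses.SqueezeCycle.RecurrentLiouville := by
  intro u p G C hsw hwg hI hdec hrec hsing
  obtain ⟨u', p', G', C₁, hsw', hwg', hI', hdec', hrec', hsing', hhull⟩ :=
    hS1a ⟨u, p, G, C, hsw, hwg, hI, hdec, hrec, hsing⟩
  obtain ⟨w, C', -, hsww, hwgw, hIw, hdecw, -, hsingw⟩ :=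
    stub_satApexOfNoSatellites u' p' G' C₁ hsw' hwg' hI' hdec' hrec' hsing' hhull
  exact hAL w p' G' C' hsww hwgw hIw hdecw hsingw

/-- **The crux splits exactly** (registered tools stub of line `Sketch`):
`RecurrentLiouville ↔ (S1a ∧ AL)` — hull satellite-freeness (the registered open stub
`stub_satHullNoSatellites`, inlined) AND apex-class Type-I Liouville (inlined; `Iff.rfl`-identical
to the open item stmt-NavierStokesRegularity-11716 `Theses.RellichScar.NoApexTypeIProfile`,
equivalent to the residual stub `stub_satRadiatingLiouville` by `stub_satRadiatingResidualTools`).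
[cite: AlbrittonBarker2019, Thm. 1.1 and §3] [cite: KNSS2009, (1.6)] -/
theorem stub_satSplitTools :
    Theses.SqueezeCycle.RecurrentLiouville ↔
      (((∃ (u : ℝ → EuclideanSpace ℝ (Fin 3) → EuclideanSpace ℝ (Fin 3))
        (p : ℝ → EuclideanSpace ℝ (Fin 3) → ℝ)
        (G : ℝ → EuclideanSpace ℝ (Fin 3) → EuclideanSpace ℝ (Fin 3) →L[ℝ] EuclideanSpace ℝ (Fin 3)) (C : ℝ),
        IsSuitableWeakSolutionOn (slab (EuclideanSpace ℝ (Fin 3)) (Iio 0) isOpen_Iio) 1 0 u p ∧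
        HasWeakSpatialGradientOn (slab (EuclideanSpace ℝ (Fin 3)) (Iio 0) isOpen_Iio) u G ∧
        typeIBound (Iio (0 : ℝ) ×ˢ univ) u p G < ⊤ ∧ HasTypeITimeDecay C u ∧
        IsScalingUniformlyRecurrent u ∧ IsBackwardSingularPoint u 0) →
      ∃ (u : ℝ → EuclideanSpace ℝ (Fin 3) → EuclideanSpace ℝ (Fin 3))
        (p : ℝ → EuclideanSpace ℝ (Fin 3) → ℝ)
        (G : ℝ → EuclideanSpace ℝ (Fin 3) → EuclideanSpace ℝ (Fin 3) →L[ℝ] EuclideanSpace ℝ (Fin 3)) (C : ℝ),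
        IsSuitableWeakSolutionOn (slab (EuclideanSpace ℝ (Fin 3)) (Iio 0) isOpen_Iio) 1 0 u p ∧
        HasWeakSpatialGradientOn (slab (EuclideanSpace ℝ (Fin 3)) (Iio 0) isOpen_Iio) u G ∧
        typeIBound (Iio (0 : ℝ) ×ˢ univ) u p G < ⊤ ∧ HasTypeITimeDecay C u ∧
        IsScalingUniformlyRecurrent u ∧ IsBackwardSingularPoint u 0 ∧
        ∀ (c : ℕ → ℝ) (v : ℝ → EuclideanSpace ℝ (Fin 3) → EuclideanSpace ℝ (Fin 3))
          (q : ℝ → EuclideanSpace ℝ (Fin 3) → ℝ)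
          (H : ℝ → EuclideanSpace ℝ (Fin 3) → EuclideanSpace ℝ (Fin 3) →L[ℝ] EuclideanSpace ℝ (Fin 3)),
          (∀ n, 0 < c n) →
          IsSuitableWeakSolutionOn (slab (EuclideanSpace ℝ (Fin 3)) (Iio 0) isOpen_Iio) 1 0 v q →
          HasWeakSpatialGradientOn (slab (EuclideanSpace ℝ (Fin 3)) (Iio 0) isOpen_Iio) v H →
          typeIBound (Iio (0 : ℝ) ×ˢ univ) v q H < ⊤ → HasTypeITimeDecay C v →
          IsBackwardSingularPoint v 0 →
          (∀ R : ℝ, 0 < R → Tendsto (fun n => eLpNorm (uncurry (nsRescale (c n) u) - uncurry v) 3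
            (volume.restrict (parabolicCylinder R (0 : ℝ × EuclideanSpace ℝ (Fin 3))))) atTop (𝓝 0)) →
          ∀ x : EuclideanSpace ℝ (Fin 3), x ≠ 0 → ¬ IsBackwardSingularPoint v (0, x)) ∧
      (∀ (u : ℝ → EuclideanSpace ℝ (Fin 3) → EuclideanSpace ℝ (Fin 3))
        (p : ℝ → EuclideanSpace ℝ (Fin 3) → ℝ)
        (G : ℝ → EuclideanSpace ℝ (Fin 3) → EuclideanSpace ℝ (Fin 3) →L[ℝ] EuclideanSpace ℝ (Fin 3)) (C : ℝ),
        IsSuitableWeakSolutionOn (slab (EuclideanSpace ℝ (Fin 3)) (Iio 0) isOpen_Iio) 1 0 u p →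
        HasWeakSpatialGradientOn (slab (EuclideanSpace ℝ (Fin 3)) (Iio 0) isOpen_Iio) u G →
        typeIBound (Iio (0 : ℝ) ×ˢ univ) u p G < ⊤ → HasTypeIDecay C u →
        ¬ IsBackwardSingularPoint u 0)) :=
  ⟨fun hL => ⟨satSP_hullNoSatellites_of_recurrentLiouville hL, satSP_apexLiouville_of_recurrentLiouville hL⟩,
    fun h => satSP_recurrentLiouville_of_split h.1 h.2⟩

end Summit.NavierStokesRegularity.NavierStokesRegularity.Theorems

end
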